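import Summits.CriticalPhenomena.PercolationContinuityZ3.Theorems.PercNearOneGluingNoHeavyLowerTailThreePartitionCombBridgeConverse
import Summits.CriticalPhenomena.PercolationContinuityZ3.Theorems.PercNearOneGluingNoHeavyLowerTailSahiC4CombStatement
import Literature.Combinatorics.Sahi2008.CumulationCone

/-!
# `NoHeavyLowerTail` (crux stmt-CriticalPhenomena-4575), comb hierarchy at `k = 4`: the two typed forms of (M⁺-4) coincide —
# `SahiC4Cube.SahiE4CombPositivity ⟺ MasterFamilyCombPos 4`

Support file (cell `prim-l12`, seat P3, gen 2; `--supports stmt-CriticalPhenomena-4575`).  No `sorry`, standard axioms; nothing is asserted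
about the crux, and the two conjectures appear only as the two sides of an equivalence.

The tree has two typings of "(M⁺-4): every degree-4 tensor-Bernstein coefficient of `p ↦ E₄(μ_p; 1_A,1_B,1_C,1_D)` is `≥ 0`":
* `SahiC4Cube.SahiE4CombPositivity` (`…SahiC4CombStatement`, prim-masterthm-p3): on the cubes `Fin m`, the INTEGER coefficients
  `e4Coef m (encA A) … k ≥ 0` for every key `k : Fin m → Fin 5` (`sahiE4_bernstein_expansion` identifies them with the expansion of
  `sahiE4 (prodBernoulli p)` in the basis `∏_i bern5 (p_i) (k_i)`);
* `MasterFamilyCombPos 4` (`…SahiCombMasterFamily`): on every finite `ι`, `CombPos (fun _ => 4)` of `p ↦ E₄(μ_p; 1_U)` — SOME nonnegative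
  representation in the basis `bern (fun _ => 4) j`, `j ∈ box 4`.
They are equivalent (`sahiE4CombPositivity_iff_masterFamilyCombPos_four`).  Ingredients: the uniqueness of tensor-Bernstein coefficients
(`ThreePartition.bern_coeff_unique`, this seat's bridge file) for `⟸`; for `⟹`, a relabelling transport of `CombPos` and of `E_k` under
the product weight along `ι ≃ Fin (card ι)` (`CombPos.comp_equiv`, `sahiE_bernoulliWeight_comap_equiv`, via the Literature lemma
`sahiE_comp_equiv`).  By-products: `sahiE_four_ind_bernstein` (the `E₄` expansion in the `box`/`bern` vocabulary),
`e4Coef_nonneg_of_combPos` / `combPos_of_e4Coef_nonneg` (per quadruple: comb positivity ⟺ `e4Coef ≥ 0`).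
-/

noncomputable section

open scoped Classical

namespace Summit.CriticalPhenomena.PercolationContinuityZ3.Theorems

namespace SahiC4CombBridge

open Finset Function
open Literature.Combinatorics.Sahi2008
open Literature.Probability.Percolation.DecisionTree (ind ind_of_mem ind_of_not_mem ind_nonneg)
open Literature.Probability.Percolation.BHK2006 (weight)
open SahiComb SahiC4Cube FourCopyCert
open SahiC3Cube (encA)

/-! ### Keys `Fin m → Fin 5` versus profiles in `box 4` -/

section FinCube

variable {m : ℕ}

/-- A key as a profile. [this work] -/
def keyProf (k : Fin m → Fin 5) : Fin m → ℕ := fun i => (k i : ℕ)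

/-- A profile as a key (truncated at `4`). [this work] -/
def profKey (j : Fin m → ℕ) : Fin m → Fin 5 := fun i => ⟨min (j i) 4, by omega⟩

/-- Keys lie in the box `j ≤ 4`. [this work] -/
theorem keyProf_mem_box (k : Fin m → Fin 5) : keyProf k ∈ box (fun _ : Fin m => 4) :=
  mem_box.2 fun i => by have := (k i).2; simp only [keyProf]; omega

/-- `profKey ∘ keyProf = id`. [this work] -/
theorem profKey_keyProf (k : Fin m → Fin 5) : profKey (keyProf k) = k := by
  funext i; apply Fin.ext; have := (k i).2; simp only [profKey, keyProf]; omega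

/-- `keyProf ∘ profKey = id` on the box. [this work] -/
theorem keyProf_profKey {j : Fin m → ℕ} (hj : j ∈ box (fun _ : Fin m => 4)) : keyProf (profKey j) = j := by
  funext i; have := mem_box.1 hj i; simp only [profKey, keyProf]; omega

/-- The two degree-4 bases agree: `∏_i bern5 (p_i) (k_i) = bern 4 (keyProf k) p`. [this work] -/
theorem prod_bern5_eq_bern (p : Fin m → unitInterval) (k : Fin m → Fin 5) :
    ∏ i, bern5 (p i : ℝ) (k i) = bern (fun _ : Fin m => 4) (keyProf k) p := rfl

/-- **The degree-4 expansion of `E₄` in the `box`/`bern` vocabulary**: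
`E₄(μ_p; 1_A,1_B,1_C,1_D) = Σ_{j ≤ 4} e4Coef(profKey j) · bern 4 j p` on the cube `Fin m`. [this work] -/
theorem sahiE_four_ind_bernstein (p : Fin m → unitInterval) (A B C D : Set (Set (Fin m))) :
    sahiE (bernoulliWeight p) 4 ![ind A, ind B, ind C, ind D] =
      ∑ j ∈ box (fun _ : Fin m => 4),
        (e4Coef m (encA m A) (encA m B) (encA m C) (encA m D) (profKey j) : ℝ) * bern (fun _ : Fin m => 4) j p := by
  rw [sahiE_four_ind, sahiE4_bernstein_expansion]
  refine sum_nbij' keyProf profKey (fun k _ => keyProf_mem_box k) (fun j _ => mem_univ _) (fun k _ => profKey_keyProf k)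
    (fun j hj => keyProf_profKey hj) (fun k _ => ?_)
  rw [profKey_keyProf, prod_bern5_eq_bern]

/-- **Per quadruple, `⟸`**: comb positivity of `E₄(1_A,1_B,1_C,1_D)` forces `e4Coef ≥ 0` at every key (uniqueness of tensor-Bernstein
coefficients). [this work] -/
theorem e4Coef_nonneg_of_combPos {A B C D : Set (Set (Fin m))}
    (h : CombPos (fun _ : Fin m => 4) (fun p => sahiE (bernoulliWeight p) 4 ![ind A, ind B, ind C, ind D]))
    (k : Fin m → Fin 5) : 0 ≤ e4Coef m (encA m A) (encA m B) (encA m C) (encA m D) k := by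
  obtain ⟨N, hN, hF⟩ := h
  have hu := ThreePartition.bern_coeff_unique
    (N := fun j => (e4Coef m (encA m A) (encA m B) (encA m C) (encA m D) (profKey j) : ℝ)) (N' := N)
    (fun p => by rw [← sahiE_four_ind_bernstein]; exact hF p) (keyProf_mem_box k)
  have h0 : (0 : ℝ) ≤ (e4Coef m (encA m A) (encA m B) (encA m C) (encA m D) (profKey (keyProf k)) : ℝ) := by
    have := hN (keyProf k); rw [← hu] at this; exact this
  rw [profKey_keyProf] at h0
  exact_mod_cast h0

/-- **Per quadruple, `⟹`**: `e4Coef ≥ 0` at every key is a comb-positivity certificate. [this work] -/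
theorem combPos_of_e4Coef_nonneg {A B C D : Set (Set (Fin m))}
    (h : ∀ k : Fin m → Fin 5, 0 ≤ e4Coef m (encA m A) (encA m B) (encA m C) (encA m D) k) :
    CombPos (fun _ : Fin m => 4) (fun p => sahiE (bernoulliWeight p) 4 ![ind A, ind B, ind C, ind D]) :=
  ⟨fun j => (e4Coef m (encA m A) (encA m B) (encA m C) (encA m D) (profKey j) : ℝ), fun j => by
    show (0 : ℝ) ≤ (e4Coef m (encA m A) (encA m B) (encA m C) (encA m D) (profKey j) : ℝ)
    exact_mod_cast h _,
    fun p => sahiE_four_ind_bernstein p A B C D⟩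

/-- Matrix-literal plumbing for `Fin 4`-families. [folklore] -/
theorem ind_vec4 {ι : Type} (U : Fin 4 → Set (Set ι)) :
    (fun j => ind (U j)) = ![ind (U 0), ind (U 1), ind (U 2), ind (U 3)] := by
  funext j; fin_cases j <;> rfl

/-- **`MasterFamilyCombPos 4 ⟹ SahiE4CombPositivity`.** [this work] -/
theorem sahiE4CombPositivity_of_masterFamilyCombPos_four (h : MasterFamilyCombPos 4) : SahiE4CombPositivity := by
  intro m A B C D hA hB hC hD k
  have hC := h (Fin m) ![A, B, C, D] fun j => by fin_cases j <;> assumption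
  rw [ind_vec4 ![A, B, C, D]] at hC
  exact e4Coef_nonneg_of_combPos hC k

end FinCube

/-! ### Relabelling transport of `CombPos` and of `E_k` under the product weight -/

section Transport

variable {ι κ : Type} [Fintype ι] [Fintype κ]

/-- Basis functions transport along a relabelling: `bern_κ c j (p ∘ e⁻¹) = bern_ι (c ∘ e) (j ∘ e) p`. [this work] -/
theorem bern_comp_equiv (e : ι ≃ κ) (c j : κ → ℕ) (p : ι → unitInterval) :
    bern c j (p ∘ e.symm) = bern (c ∘ e) (j ∘ e) p := by
  unfold bern
  exact (Fintype.prod_equiv e _ _ fun i => by simp).symm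

/-- **`CombPos` transports along a relabelling of the coordinates.** [this work] -/
theorem CombPos.comp_equiv (e : ι ≃ κ) {c : κ → ℕ} {F : (κ → unitInterval) → ℝ} (h : CombPos c F) :
    CombPos (c ∘ e) (fun p : ι → unitInterval => F (p ∘ e.symm)) := by
  obtain ⟨N, hN, hF⟩ := h
  refine ⟨fun j => N (j ∘ e.symm), fun j => hN _, fun p => ?_⟩
  change F (p ∘ e.symm) = _
  rw [hF]
  refine sum_nbij' (fun j' => j' ∘ e) (fun j => j ∘ e.symm) (fun j' hj' => ?_) (fun j hj => ?_) (fun j' _ => ?_) (fun j _ => ?_)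
    (fun j' _ => ?_)
  · rw [mem_box] at hj' ⊢; intro i; exact hj' (e i)
  · rw [mem_box] at hj ⊢; intro i'; simpa using hj (e.symm i')
  · funext i'; simp
  · funext i; simp
  · have : ((j' ∘ e) ∘ e.symm) = j' := by funext i'; simp
    dsimp only
    rw [this, bern_comp_equiv]

omit [Fintype ι] [Fintype κ] in
/-- Pull back a family of events along `e : ι ≃ κ`: `{ω' ⊆ κ | e⁻¹(ω') ∈ U}` (= `ThreePartition.comapFam e.symm U`). [this work] -/
theorem isUpperSet_comapFam (e : ι ≃ κ) {U : Set (Set ι)} (hU : IsUpperSet U) :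
    IsUpperSet (ThreePartition.comapFam e.symm U) :=
  fun _ _ hle hω => hU (Set.image_mono hle) hω

/-- The product weight transports: `μ_{p ∘ e⁻¹}(e(ω)) = μ_p(ω)`. [this work] -/
theorem bernoulliWeight_comp_equiv (e : ι ≃ κ) (p : ι → unitInterval) (ω : Set ι) :
    bernoulliWeight (p ∘ e.symm) (e '' ω) = bernoulliWeight p ω := by
  simp only [bernoulliWeight, weight]
  exact (Fintype.prod_equiv e _ _ fun i => by simp).symm

omit [Fintype ι] [Fintype κ] in
/-- Indicators of pulled-back events transport. [this work] -/
theorem ind_comapFam_image (e : ι ≃ κ) (U : Set (Set ι)) (ω : Set ι) :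
    ind (ThreePartition.comapFam e.symm U) (e '' ω) = ind U ω := by
  have key : e '' ω ∈ ThreePartition.comapFam e.symm U ↔ ω ∈ U := by
    simp only [ThreePartition.comapFam, Set.mem_setOf_eq, Equiv.symm_image_image]
  by_cases hω : ω ∈ U
  · rw [ind_of_mem hω, ind_of_mem (key.2 hω)]
  · rw [ind_of_not_mem hω, ind_of_not_mem fun h' => hω (key.1 h')]

/-- **`E_k` under the product weight is invariant under relabelling the coordinates** (events pulled back, probabilities relabelled).
[this work] -/
theorem sahiE_bernoulliWeight_comap_equiv (e : ι ≃ κ) (p : ι → unitInterval) (k : ℕ) (U : Fin k → Set (Set ι)) :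
    sahiE (bernoulliWeight (p ∘ e.symm)) k (fun j => ind (ThreePartition.comapFam e.symm (U j))) =
      sahiE (bernoulliWeight p) k (fun j => ind (U j)) := by
  have h := sahiE_comp_equiv (Equiv.Set.congr e) (bernoulliWeight (p ∘ e.symm)) k
    (fun j => ind (ThreePartition.comapFam e.symm (U j)))
  have hμ : (bernoulliWeight (p ∘ e.symm) ∘ (Equiv.Set.congr e)) = bernoulliWeight p := by
    funext ω; exact bernoulliWeight_comp_equiv e p ω
  have hf : (fun j => ind (ThreePartition.comapFam e.symm (U j)) ∘ (Equiv.Set.congr e)) = fun j => ind (U j) := by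
    funext j ω; exact ind_comapFam_image e (U j) ω
  rw [hμ, hf] at h
  exact h.symm

end Transport

/-! ### The equivalence -/

/-- **`SahiE4CombPositivity ⟹ MasterFamilyCombPos 4`**: relabel `ι ≃ Fin (card ι)`, certify on the cube by `e4Coef ≥ 0`, transport back.
[this work] -/
theorem masterFamilyCombPos_four_of_sahiE4CombPositivity (h : SahiE4CombPositivity) : MasterFamilyCombPos 4 := by
  intro ι _ U hU
  obtain ⟨e⟩ : Nonempty (ι ≃ Fin (Fintype.card ι)) := ⟨Fintype.equivFin ι⟩
  have hU'up : ∀ j, IsUpperSet (ThreePartition.comapFam e.symm (U j)) := fun j => isUpperSet_comapFam e (hU j)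
  have hcube : CombPos (fun _ : Fin (Fintype.card ι) => 4)
      (fun p' => sahiE (bernoulliWeight p') 4 (fun j => ind (ThreePartition.comapFam e.symm (U j)))) := by
    rw [ind_vec4 (fun j => ThreePartition.comapFam e.symm (U j))]
    exact combPos_of_e4Coef_nonneg (h _ _ _ _ _ (hU'up 0) (hU'up 1) (hU'up 2) (hU'up 3))
  have ht := CombPos.comp_equiv e hcube
  exact ht.congr fun p => (sahiE_bernoulliWeight_comap_equiv e p 4 U).symm

/-- **(M⁺-4), the two typings coincide**: `SahiE4CombPositivity ⟺ MasterFamilyCombPos 4`. [this work] -/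
theorem sahiE4CombPositivity_iff_masterFamilyCombPos_four : SahiE4CombPositivity ↔ MasterFamilyCombPos 4 :=
  ⟨masterFamilyCombPos_four_of_sahiE4CombPositivity, sahiE4CombPositivity_of_masterFamilyCombPos_four⟩

end SahiC4CombBridge

end Summit.CriticalPhenomena.PercolationContinuityZ3.Theorems
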